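import Summits.HubbardSuperconductivity.HubbardSuperconductivity.Theorems.BcsKacWindowInfraredCompletionSqrtShape
import Summits.HubbardSuperconductivity.HubbardSuperconductivity.Theorems.FunctionFieldCertificateWindowInfraredBoundSpinBloch

/-!
# Crux `InfraredCompletion` (stmt-HubbardSuperconductivity-1321, route BcsKacWindow), line `birth`:
# spin × Bloch reduction of the two stubs and of the crux's conclusion (pointwise lemmas)

The crux and both stubs of skeleton v5 of line `birth` are EVERY-ground-state statements: for every
normalised `(N_L, S^z = 0)`-sector ground state `ψ` of `hubbardTorus 2 L 1 U` on a bulk torus,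
(A) a soft-window FLOOR `F ≤ Σ_{|q_m|² ≤ r²} S_ψ(m)`, (B3) the SQRT-SHAPE
`S_ψ(m)|q_m|L² ≤ A·L·√S_ψ(0) + K` at a nonzero soft label `m`, and (conclusion) the bulk order
`c₁Δ(U)² ≤ Re⟨ψ, Δ_d†Δ_d ψ⟩/L⁴`, i.e. `c₁Δ²L² ≤ S_ψ(0)`. This file shows, at fixed data
`(L, U, N, r / m, constants)`, that each of the three needs to be verified ONLY on ground states that
are joint eigenvectors of all lattice translations `fockTranslate v` (Bloch states) and of the
total-spin Casimir `spinSq`: the every-ground-state clause costs nothing beyond symmetric ground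
states (degenerate multiplets at level crossings included).

* `windowWeight_modeSum_eq`, `softWindowFloorAt_of_spinBloch` — the floor is (minus) a real-weighted
  mode sum `Σ_m w_m ‖Δ_d(m)ψ‖²` with `w = -𝟙_{|q_m|² ≤ r²}`, so the landed
  `forall_ground_modeSum_le_of_spinBloch` (sibling crux `WindowInfraredBound`) applies verbatim;
* `orderFloorAt_of_spinBloch` — the same with `w = -𝟙_{m = 0}` for the bulk-order conclusion;
* `sqrtShapeAt_of_spinBloch` — the sqrt-shape is NOT linear in the quadratic forms, but it is the
  conjunction over `λ > 0` of the linear inequalities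
  `S_ψ(m)|q_m|L² - (A L/(2λ)) S_ψ(0) ≤ A L λ/2 + K` (AM–GM `√x ≤ x/(2λ) + λ/2`, equality at
  `λ = √x`), each of which is a weighted mode sum with two weights (`|q_m|` at `m`, `-A/(2λL)` at
  `0 ≠ m`); so it, too, transfers from spin-Bloch ground states to all ground states.

The quantified corollaries for the registered stubs (`stub_softWindowFloor`,
`stub_sqrtGoldstoneShape`) and for the crux body are in the companion file
`BcsKacWindowInfraredCompletionBlochReductionStubs.lean`. No definitions, no named facts,
`sorry`-free. Sources: H. Tasaki, *Physics and Mathematics of Quantum Many-Body Systems* (2020),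
§2.1, §4.1 (symmetric ground states in degenerate multiplets); T. Kennedy, E. H. Lieb,
B. S. Shastry, PRL **61** (1988) 2582. Lead c15, 2026-08-17. [folklore]
-/

noncomputable section

-- the mandated namespace `Summit.<Summit>.<Problem>.Theorems…` repeats `HubbardSuperconductivity`
-- (single-problem summit, D-0017), which the `dupNamespace` linter flags on every declaration
set_option linter.dupNamespace false

namespace Summit.HubbardSuperconductivity.HubbardSuperconductivity.Theorems.InfraredCompletion

open Literature.MathematicalPhysics.QuantumLattice Literature.Probability.LatticeModels
open Summit.HubbardSuperconductivity.HubbardSuperconductivity.Theorems.WindowInfraredBound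
  (forall_ground_modeSum_le_of_spinBloch)
open scoped Matrix

/-! ### The pair weight of a mode as a multiple of the structure factor -/

/-- `‖Δ_d(m)ψ‖² = S_ψ(m) · L²` (`pairStructureFactor` unfolded and cleared of its denominator).
[folklore] -/
theorem pairWeight_eq_pairStructureFactor_mul_sq {L : ℕ} [NeZero L]
    (ψ : Fock (Orb (FermionTorus 2 L))) (m : TorusSite 2 L) :
    (star (pairFieldAt dWaveFormFactor L m *ᵥ ψ) ⬝ᵥ (pairFieldAt dWaveFormFactor L m *ᵥ ψ)).re =
      pairStructureFactor dWaveFormFactor L ψ m * (L : ℝ) ^ 2 := by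
  have hL : (0 : ℝ) < (L : ℝ) := Nat.cast_pos.2 (Nat.pos_of_ne_zero (NeZero.ne L))
  have hL2 : (L : ℝ) ^ 2 ≠ 0 := by positivity
  rw [pairStructureFactor_apply, div_mul_cancel₀ _ hL2]

/-! ### Floors: linear in the quadratic forms -/

/-- The (negative) window indicator as a weight turns the mode sum into minus the soft-window sum:
`Σ_m (-𝟙_{|q_m|² ≤ r²}) ‖Δ_d(m)ψ‖² = -L² · Σ_{|q_m|² ≤ r²} S_ψ(m)`. [folklore] -/
theorem windowWeight_modeSum_eq {L : ℕ} [NeZero L] (ψ : Fock (Orb (FermionTorus 2 L))) (r : ℝ) :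
    ∑ m : TorusSite 2 L, (if momentumNormSq L m ≤ r ^ 2 then (-1 : ℝ) else 0) *
        (star (pairFieldAt dWaveFormFactor L m *ᵥ ψ) ⬝ᵥ (pairFieldAt dWaveFormFactor L m *ᵥ ψ)).re =
      -((L : ℝ) ^ 2 * ∑ m ∈ Finset.univ.filter
          (fun m : Fin 2 → ZMod L => momentumNormSq L m ≤ r ^ 2),
        pairStructureFactor dWaveFormFactor L ψ m) := by
  rw [Finset.mul_sum, ← Finset.sum_neg_distrib, Finset.sum_filter]
  refine Finset.sum_congr rfl fun m _ => ?_
  rw [pairWeight_eq_pairStructureFactor_mul_sq]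
  split_ifs <;> ring

/-- **Spin × Bloch reduction of a soft-window floor, at fixed data.** If every normalised
`(N, S^z = 0)`-sector ground state of `hubbardTorus 2 L 1 U` that is an eigenvector of every
translation `fockTranslate v` and of `spinSq` has `F ≤ Σ_{|q_m|² ≤ r²} S_ψ(m)`, then every
normalised sector ground state has it (the floor is minus a real-weighted mode sum,
`windowWeight_modeSum_eq`, and `forall_ground_modeSum_le_of_spinBloch` applies).
Tasaki (2020) §2.1, §4.1. [folklore] -/
theorem softWindowFloorAt_of_spinBloch (L : ℕ) [NeZero L] (U : ℝ) (N : ℕ) (r F : ℝ)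
    (h : ∀ ψ : Fock (Orb (FermionTorus 2 L)), star ψ ⬝ᵥ ψ = 1 →
      IsGroundStateInSector (hubbardTorus 2 L 1 U) N 0 ψ →
        (∀ v : TorusSite 2 L, ∃ c : ℂ, (fockTranslate v).val *ᵥ ψ = c • ψ) →
          (∃ s : ℂ, (spinSq : Matrix (Finset (Orb (FermionTorus 2 L)))
            (Finset (Orb (FermionTorus 2 L))) ℂ) *ᵥ ψ = s • ψ) →
            F ≤ ∑ m ∈ Finset.univ.filter
                (fun m : Fin 2 → ZMod L => momentumNormSq L m ≤ r ^ 2),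
              pairStructureFactor dWaveFormFactor L ψ m)
    (ψ : Fock (Orb (FermionTorus 2 L))) (hψ : star ψ ⬝ᵥ ψ = 1)
    (hgs : IsGroundStateInSector (hubbardTorus 2 L 1 U) N 0 ψ) :
    F ≤ ∑ m ∈ Finset.univ.filter (fun m : Fin 2 → ZMod L => momentumNormSq L m ≤ r ^ 2),
      pairStructureFactor dWaveFormFactor L ψ m := by
  have hL : (0 : ℝ) < (L : ℝ) := Nat.cast_pos.2 (Nat.pos_of_ne_zero (NeZero.ne L))
  have hL2 : (0 : ℝ) < (L : ℝ) ^ 2 := by positivity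
  have key := forall_ground_modeSum_le_of_spinBloch L dWaveFormFactor 1 U N 0
    (fun m : TorusSite 2 L => if momentumNormSq L m ≤ r ^ 2 then (-1 : ℝ) else 0)
    (-((L : ℝ) ^ 2 * F)) (fun φ hφ hφgs hbl hsp => by
      rw [windowWeight_modeSum_eq]
      have := h φ hφ hφgs hbl hsp
      nlinarith [this, hL2]) ψ hψ hgs
  rw [windowWeight_modeSum_eq] at key
  nlinarith [key, hL2]

/-- The (negative) zero-mode indicator as a weight gives minus the zero mode:
`Σ_m (-𝟙_{m = 0}) ‖Δ_d(m)ψ‖² = -L² · S_ψ(0)`. [folklore] -/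
theorem zeroWeight_modeSum_eq {L : ℕ} [NeZero L] (ψ : Fock (Orb (FermionTorus 2 L))) :
    ∑ m : TorusSite 2 L, (if m = 0 then (-1 : ℝ) else 0) *
        (star (pairFieldAt dWaveFormFactor L m *ᵥ ψ) ⬝ᵥ (pairFieldAt dWaveFormFactor L m *ᵥ ψ)).re =
      -((L : ℝ) ^ 2 * pairStructureFactor dWaveFormFactor L ψ 0) := by
  simp only [ite_mul, zero_mul, Finset.sum_ite_eq', Finset.mem_univ, if_true]
  rw [pairWeight_eq_pairStructureFactor_mul_sq]
  ring

/-- **Spin × Bloch reduction of the bulk-order floor, at fixed data.** If every normalised sector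
ground state that is an eigenvector of every translation and of `spinSq` has
`c ≤ Re⟨ψ, Δ_d†Δ_d ψ⟩/L⁴`, then every normalised sector ground state has it
(`Re⟨ψ, Δ_d†Δ_d ψ⟩/L⁴ = S_ψ(0)/L²`, `pairStructureFactor_zero`; weight `-𝟙_{m = 0}`).
Tasaki (2020) §2.1, §4.1. [folklore] -/
theorem orderFloorAt_of_spinBloch (L : ℕ) [NeZero L] (U : ℝ) (N : ℕ) (c : ℝ)
    (h : ∀ ψ : Fock (Orb (FermionTorus 2 L)), star ψ ⬝ᵥ ψ = 1 →
      IsGroundStateInSector (hubbardTorus 2 L 1 U) N 0 ψ →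
        (∀ v : TorusSite 2 L, ∃ c : ℂ, (fockTranslate v).val *ᵥ ψ = c • ψ) →
          (∃ s : ℂ, (spinSq : Matrix (Finset (Orb (FermionTorus 2 L)))
            (Finset (Orb (FermionTorus 2 L))) ℂ) *ᵥ ψ = s • ψ) →
            c ≤ (expect ((pairField dWaveFormFactor L)ᴴ * pairField dWaveFormFactor L) ψ).re /
              (L : ℝ) ^ 4)
    (ψ : Fock (Orb (FermionTorus 2 L))) (hψ : star ψ ⬝ᵥ ψ = 1)
    (hgs : IsGroundStateInSector (hubbardTorus 2 L 1 U) N 0 ψ) :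
    c ≤ (expect ((pairField dWaveFormFactor L)ᴴ * pairField dWaveFormFactor L) ψ).re /
      (L : ℝ) ^ 4 := by
  have hL : (0 : ℝ) < (L : ℝ) := Nat.cast_pos.2 (Nat.pos_of_ne_zero (NeZero.ne L))
  have hL2 : (0 : ℝ) < (L : ℝ) ^ 2 := by positivity
  have hL4 : (0 : ℝ) < (L : ℝ) ^ 4 := by positivity
  -- `c ≤ Re⟨⟩/L⁴ ↔ c L² ≤ S(0)` for any vector
  have hiff : ∀ φ : Fock (Orb (FermionTorus 2 L)),
      c ≤ (expect ((pairField dWaveFormFactor L)ᴴ * pairField dWaveFormFactor L) φ).re /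
        (L : ℝ) ^ 4 ↔ c * (L : ℝ) ^ 2 ≤ pairStructureFactor dWaveFormFactor L φ 0 := by
    intro φ
    rw [pairStructureFactor_zero, le_div_iff₀ hL4, le_div_iff₀ hL2]
    constructor
    · intro h'; nlinarith [h']
    · intro h'; nlinarith [h']
  have key := forall_ground_modeSum_le_of_spinBloch L dWaveFormFactor 1 U N 0
    (fun m : TorusSite 2 L => if m = 0 then (-1 : ℝ) else 0)
    (-((L : ℝ) ^ 2 * (c * (L : ℝ) ^ 2))) (fun φ hφ hφgs hbl hsp => by
      rw [zeroWeight_modeSum_eq]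
      have := (hiff φ).1 (h φ hφ hφgs hbl hsp)
      nlinarith [this, hL2]) ψ hψ hgs
  rw [zeroWeight_modeSum_eq] at key
  exact (hiff ψ).2 (by nlinarith [key, hL2])

/-! ### The sqrt-shape: a conjunction of linear inequalities -/

/-- AM–GM in the form used here: `√x ≤ x/(2λ) + λ/2` for `λ > 0`, `x ≥ 0`. [folklore] -/
theorem sqrt_le_div_add (x lam : ℝ) (hx : 0 ≤ x) (hlam : 0 < lam) :
    Real.sqrt x ≤ x / (2 * lam) + lam / 2 := by
  have hs : 0 ≤ Real.sqrt x := Real.sqrt_nonneg x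
  have hsq : Real.sqrt x * Real.sqrt x = x := Real.mul_self_sqrt hx
  rw [div_add_div _ _ (by positivity) two_ne_zero, le_div_iff₀ (by positivity)]
  nlinarith [mul_self_nonneg (Real.sqrt x - lam)]

/-- The two-point weight of the `λ`-linearised sqrt-shape turns the mode sum into
`S_ψ(m)|q_m|L² - (A L/(2λ)) S_ψ(0)` (at `m = 0` both sides degenerate consistently, `|q_0| = 0`).
[folklore] -/
theorem twoPointWeight_modeSum_eq {L : ℕ} [NeZero L] (ψ : Fock (Orb (FermionTorus 2 L)))
    (m : TorusSite 2 L) (A lam : ℝ) :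
    ∑ m' : TorusSite 2 L,
        ((if m' = m then Real.sqrt (momentumNormSq L m) else 0) +
            (if m' = 0 then -(A / (2 * lam * (L : ℝ))) else 0)) *
          (star (pairFieldAt dWaveFormFactor L m' *ᵥ ψ) ⬝ᵥ
            (pairFieldAt dWaveFormFactor L m' *ᵥ ψ)).re =
      pairStructureFactor dWaveFormFactor L ψ m * Real.sqrt (momentumNormSq L m) * (L : ℝ) ^ 2 -
        A * (L : ℝ) / (2 * lam) * pairStructureFactor dWaveFormFactor L ψ 0 := by
  have hL : (0 : ℝ) < (L : ℝ) := Nat.cast_pos.2 (Nat.pos_of_ne_zero (NeZero.ne L))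
  have hL0 : (L : ℝ) ≠ 0 := hL.ne'
  simp only [add_mul, Finset.sum_add_distrib, ite_mul, zero_mul, Finset.sum_ite_eq',
    Finset.mem_univ, if_true]
  rw [pairWeight_eq_pairStructureFactor_mul_sq, pairWeight_eq_pairStructureFactor_mul_sq]
  field_simp
  ring

/-- **Spin × Bloch reduction of the sqrt-shape at one label, at fixed data** (registered sub-goal
`sqrtShapeAt_of_spinBloch` of stmt-HubbardSuperconductivity-1321). Fix a label `m`, `A ≥ 0` and a
constant `K`. If every normalised `(N, S^z=0)`-sector ground state of
`hubbardTorus 2 L 1 U` that is an eigenvector of every translation and of `spinSq` satisfies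
`S_ψ(m)|q_m|L² ≤ A·L·√S_ψ(0) + K`, then every normalised sector ground state does. Proof: for
each `λ > 0` the hypothesis gives the LINEAR inequality `S(m)|q|L² - (AL/(2λ))S(0) ≤ ALλ/2 + K` on
symmetric ground states (`sqrt_le_div_add`), which is a two-point weighted mode sum
(`twoPointWeight_modeSum_eq`) and therefore transfers to all ground states
(`forall_ground_modeSum_le_of_spinBloch`); at `ψ` take `λ = √S_ψ(0)` if `S_ψ(0) > 0`, and
`λ → 0` otherwise. Tasaki (2020) §2.1, §4.1. [folklore] -/
theorem sqrtShapeAt_of_spinBloch :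
    ∀ (L : ℕ) [NeZero L] (U : ℝ) (N : ℕ) (m : TorusSite 2 L) (A K : ℝ), 0 ≤ A →
      (∀ ψ : Fock (Orb (FermionTorus 2 L)), star ψ ⬝ᵥ ψ = 1 →
        IsGroundStateInSector (hubbardTorus 2 L 1 U) N 0 ψ →
          (∀ v : TorusSite 2 L, ∃ c : ℂ, (fockTranslate v).val *ᵥ ψ = c • ψ) →
            (∃ s : ℂ, (spinSq : Matrix (Finset (Orb (FermionTorus 2 L)))
              (Finset (Orb (FermionTorus 2 L))) ℂ) *ᵥ ψ = s • ψ) →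
              pairStructureFactor dWaveFormFactor L ψ m * Real.sqrt (momentumNormSq L m) *
                  (L : ℝ) ^ 2 ≤
                A * (L : ℝ) * Real.sqrt (pairStructureFactor dWaveFormFactor L ψ 0) + K) →
      ∀ ψ : Fock (Orb (FermionTorus 2 L)), star ψ ⬝ᵥ ψ = 1 →
        IsGroundStateInSector (hubbardTorus 2 L 1 U) N 0 ψ →
          pairStructureFactor dWaveFormFactor L ψ m * Real.sqrt (momentumNormSq L m) * (L : ℝ) ^ 2 ≤
            A * (L : ℝ) * Real.sqrt (pairStructureFactor dWaveFormFactor L ψ 0) + K := by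
  intro L _ U N m A K hA h ψ hψ hgs
  have hL : (0 : ℝ) < (L : ℝ) := Nat.cast_pos.2 (Nat.pos_of_ne_zero (NeZero.ne L))
  -- the `λ`-linearised inequality holds at `ψ` for every `λ > 0`
  have hlin : ∀ lam : ℝ, 0 < lam →
      pairStructureFactor dWaveFormFactor L ψ m * Real.sqrt (momentumNormSq L m) * (L : ℝ) ^ 2 -
          A * (L : ℝ) / (2 * lam) * pairStructureFactor dWaveFormFactor L ψ 0 ≤
        A * (L : ℝ) * lam / 2 + K := by
    intro lam hlam
    have key := forall_ground_modeSum_le_of_spinBloch L dWaveFormFactor 1 U N 0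
      (fun m' : TorusSite 2 L => (if m' = m then Real.sqrt (momentumNormSq L m) else 0) +
        (if m' = 0 then -(A / (2 * lam * (L : ℝ))) else 0))
      (A * (L : ℝ) * lam / 2 + K) (fun φ hφ hφgs hbl hsp => by
        rw [twoPointWeight_modeSum_eq φ m A lam]
        have h1 := h φ hφ hφgs hbl hsp
        have hx : 0 ≤ pairStructureFactor dWaveFormFactor L φ 0 := pairStructureFactor_nonneg _ _ _ _
        have h2 := sqrt_le_div_add (pairStructureFactor dWaveFormFactor L φ 0) lam hx hlam
        have hAL : 0 ≤ A * (L : ℝ) := by positivity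
        have h3 := mul_le_mul_of_nonneg_left h2 hAL
        have e : A * (L : ℝ) * (pairStructureFactor dWaveFormFactor L φ 0 / (2 * lam) + lam / 2) =
            A * (L : ℝ) / (2 * lam) * pairStructureFactor dWaveFormFactor L φ 0 +
              A * (L : ℝ) * lam / 2 := by ring
        rw [e] at h3
        linarith [h1, h3]) ψ hψ hgs
    rw [twoPointWeight_modeSum_eq ψ m A lam] at key
    exact key
  set x : ℝ := pairStructureFactor dWaveFormFactor L ψ 0 with hxdef
  have hx : 0 ≤ x := pairStructureFactor_nonneg _ _ _ _
  rcases eq_or_lt_of_le hx with hx0 | hxpos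
  · -- `x = 0`: let `λ → 0`
    rw [← hx0, Real.sqrt_zero, mul_zero, zero_add]
    refine le_of_forall_pos_lt_add fun ε hε => ?_
    rcases eq_or_lt_of_le (by positivity : 0 ≤ A * (L : ℝ)) with hAL0 | hALpos
    · have h1 := hlin 1 one_pos
      rw [← hx0, mul_zero, sub_zero, ← hAL0] at h1
      linarith
    · have hlam : 0 < ε / (A * (L : ℝ)) := div_pos hε hALpos
      have h1 := hlin (ε / (A * (L : ℝ))) hlam
      rw [← hx0, mul_zero, sub_zero] at h1
      have e : A * (L : ℝ) * (ε / (A * (L : ℝ))) / 2 = ε / 2 := by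
        rw [mul_div_cancel₀ _ hALpos.ne']
      rw [e] at h1
      linarith
  · -- `x > 0`: take `λ = √x`
    have hs : 0 < Real.sqrt x := Real.sqrt_pos.2 hxpos
    have h1 := hlin (Real.sqrt x) hs
    have hsq : Real.sqrt x * Real.sqrt x = x := Real.mul_self_sqrt hx
    have e1 : A * (L : ℝ) / (2 * Real.sqrt x) * x = A * (L : ℝ) * Real.sqrt x / 2 := by
      rw [div_mul_eq_mul_div, div_eq_div_iff (by positivity) two_ne_zero]
      have e2 : A * (L : ℝ) * Real.sqrt x * (2 * Real.sqrt x) =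
          A * (L : ℝ) * 2 * (Real.sqrt x * Real.sqrt x) := by ring
      rw [e2, hsq]
      ring
    rw [e1] at h1
    linarith

end Summit.HubbardSuperconductivity.HubbardSuperconductivity.Theorems.InfraredCompletion

end
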